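import Mathlib
import Summits.KontsevichZagierPeriods.KontsevichZagierPeriods.Theorems.TorsionLogsGKZLevelThreePairBetaDisc
import Literature.NumberTheory.Transcendental.KZBetaChains

/-!
# Route TorsionLogs — support item `GKZLevelThreePair`: Euler's reflection at `1/3`, IV
# (the instances `a = 2/3`, `a = 1/3` of `EulerReflectionRational`, verbatim)

Helper file for item `stmt-KontsevichZagierPeriods-13812` (`GKZLevelThreePair`). The chain of Files
I–III (`beta_equivalent_disc`: `[(0,1), s^{-1/3}(1-s)^{-2/3}] ∼ [closed unit disc, 2/√3]`,
Euler's reflection `Γ(1/3)Γ(2/3) = 2π/√3` realised by Kontsevich–Zagier moves) is restated in the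
exact shape of item `EulerReflectionRational` of route CompiledSubstitutions
(stmt-KontsevichZagierPeriods-3383: `∀ a ∈ ℚ ∩ (0,1)`, `[(0,1), sin(πa) x^{a-1}(1-x)^{-a}] ∼
[closed unit disc, 1]`) at `a = 2/3` (`sin(2π/3) = √3/2`; scaling by the algebraic constant `√3/2`)
and at `a = 1/3` (one more reflection `x ↦ 1 - x`, `KZ.betaReflection_equivalent`). These are the
first instances of that crux beyond `a = 1/2` (`stubEulerReflection_half`).

## References

* G. Andrews, R. Askey, R. Roy, *Special Functions* (1999), Thm. 1.2.1 (Euler's reflection formula).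
* M. Kontsevich, D. Zagier, *Periods* (2001), §1.2.
-/

-- `Summit.<Summit>.<Sub>` with Sub = Summit (single-conjunct summit, D-0017) duplicates the segment.
set_option linter.dupNamespace false

noncomputable section

namespace Summit.KontsevichZagierPeriods.KontsevichZagierPeriods.Theorems.GKZLevelThree

open Set MeasureTheory
open Literature.NumberTheory.Transcendental Literature.NumberTheory.Transcendental.KZ

/-! ## The instances `a = 2/3`, `a = 1/3` of `EulerReflectionRational` -/

/-- `sin(2π/3) = √3/2`. -/
theorem sin_pi_mul_two_thirds : Real.sin (Real.pi * ((2 / 3 : ℚ) : ℝ)) = Real.sqrt 3 / 2 := by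
  rw [show Real.pi * ((2 / 3 : ℚ) : ℝ) = Real.pi - Real.pi / 3 by push_cast; ring, Real.sin_pi_sub,
    Real.sin_pi_div_three]

/-- `sin(π/3) = √3/2`, with the argument written `π · (1/3 : ℚ)`. -/
theorem sin_pi_mul_one_third : Real.sin (Real.pi * ((1 / 3 : ℚ) : ℝ)) = Real.sqrt 3 / 2 := by
  rw [show Real.pi * ((1 / 3 : ℚ) : ℝ) = Real.pi / 3 by push_cast; ring, Real.sin_pi_div_three]

/-- **The instance `a = 2/3` of `EulerReflectionRational`** (stmt-KontsevichZagierPeriods-3383,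
route CompiledSubstitutions; verbatim shape): `[(0,1), sin(2π/3) · x^{-1/3}(1-x)^{-2/3}] ∼
[closed unit disc, 1]` (`sin(2π/3) B(2/3,1/3) = π`). From `beta_equivalent_disc` by scaling both
sides by the algebraic constant `√3/2`. [Andrews–Askey–Roy 1999, Thm. 1.2.1] -/
theorem eulerReflectionRational_two_thirds (r : IntegralRep 1) (p : IntegralRep 2)
    (hrd : r.domain = {x | x 0 ∈ Set.Ioo (0:ℝ) 1})
    (hri : EqOn r.integrand (fun x => Real.sin (Real.pi * ((2 / 3 : ℚ) : ℝ)) *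
      (x 0) ^ (((2 / 3 : ℚ) : ℝ) - 1) * (1 - x 0) ^ (-((2 / 3 : ℚ) : ℝ))) r.domain)
    (hpd : p.domain = {z | z 0 ^ 2 + z 1 ^ 2 ≤ 1}) (hpi : EqOn p.integrand (fun _ => 1) p.domain) :
    Equivalent r p := by
  have h3pos : 0 < Real.sqrt 3 := Real.sqrt_pos.2 (by norm_num)
  have h3sq : Real.sqrt 3 ^ 2 = 3 := Real.sq_sqrt (by norm_num)
  have hc : IsAlgebraic ℚ (Real.sqrt 3 / 2) := by
    have h2 : IsAlgebraic ℚ (2:ℝ) := by simpa using isAlgebraic_nat (R := ℚ) (A := ℝ) 2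
    rw [div_eq_mul_inv]
    exact isAlgebraic_sqrt_three.mul h2.inv
  have hc0 : Real.sqrt 3 / 2 ≠ 0 := by positivity
  obtain ⟨β, hβd, hβi⟩ := exists_betaRep' (2 / 3) (1 / 3) (by norm_num) (by norm_num)
  have hβi' : EqOn β.integrand (fun x => (x 0) ^ (-(1:ℝ) / 3) * (1 - x 0) ^ (-(2:ℝ) / 3)) β.domain := by
    intro x _
    rw [hβi]
    norm_num
  -- `β ∼ [disc, 2/√3] ∼ p · (2/√3)`
  have h1 : Equivalent β (p.constMul (2 / Real.sqrt 3) isAlgebraic_two_div_sqrt_three) :=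
    beta_equivalent_disc β _ hβd hβi' (by rw [IntegralRep.domain_constMul, hpd]) fun z hz => by
      have hz' : z ∈ p.domain := by simpa using hz
      simp only [IntegralRep.integrand_constMul, hpi hz', mul_one]
  -- scale by `√3/2`
  have h2 := h1.constMul (Real.sqrt 3 / 2) hc
  have hr : Equivalent r (β.constMul (Real.sqrt 3 / 2) hc) := by
    refine of_sub_of_mem_relations_of_eqOn (by rw [IntegralRep.domain_constMul, hβd, hrd]) fun x hx => ?_
    have hx' : x ∈ β.domain := by rw [hβd, ← hrd]; exact hx
    simp only [IntegralRep.integrand_constMul]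
    rw [hri hx, hβi' hx', sin_pi_mul_two_thirds]
    norm_num
    ring
  have hp : Equivalent ((p.constMul (2 / Real.sqrt 3) isAlgebraic_two_div_sqrt_three).constMul
      (Real.sqrt 3 / 2) hc) p := by
    refine of_sub_of_mem_relations_of_eqOn rfl fun z _ => ?_
    simp only [IntegralRep.integrand_constMul]
    field_simp
  exact (hr.trans h2).trans hp

/-- **The instance `a = 1/3` of `EulerReflectionRational`**: `[(0,1), sin(π/3) · x^{-2/3}(1-x)^{-1/3}]
∼ [closed unit disc, 1]`, from the instance `a = 2/3` by the reflection `x ↦ 1 - x`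
(`KZ.betaReflection_equivalent`). [Andrews–Askey–Roy 1999, Thm. 1.2.1] -/
theorem eulerReflectionRational_one_third (r : IntegralRep 1) (p : IntegralRep 2)
    (hrd : r.domain = {x | x 0 ∈ Set.Ioo (0:ℝ) 1})
    (hri : EqOn r.integrand (fun x => Real.sin (Real.pi * ((1 / 3 : ℚ) : ℝ)) *
      (x 0) ^ (((1 / 3 : ℚ) : ℝ) - 1) * (1 - x 0) ^ (-((1 / 3 : ℚ) : ℝ))) r.domain)
    (hpd : p.domain = {z | z 0 ^ 2 + z 1 ^ 2 ≤ 1}) (hpi : EqOn p.integrand (fun _ => 1) p.domain) :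
    Equivalent r p := by
  have hc : IsAlgebraic ℚ (Real.sqrt 3 / 2) := by
    have h2 : IsAlgebraic ℚ (2:ℝ) := by simpa using isAlgebraic_nat (R := ℚ) (A := ℝ) 2
    rw [div_eq_mul_inv]
    exact isAlgebraic_sqrt_three.mul h2.inv
  -- `R₀ = [(0,1), x^{-2/3}(1-x)^{-1/3}]`, `β = [(0,1), x^{-1/3}(1-x)^{-2/3}]`
  obtain ⟨R₀, hR₀d, hR₀i⟩ := exists_betaRep' (1 / 3) (2 / 3) (by norm_num) (by norm_num)
  obtain ⟨β, hβd, hβi⟩ := exists_betaRep' (2 / 3) (1 / 3) (by norm_num) (by norm_num)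
  -- `r ∼ (√3/2) · R₀`
  have h1 : Equivalent r (R₀.constMul (Real.sqrt 3 / 2) hc) := by
    refine of_sub_of_mem_relations_of_eqOn (by rw [IntegralRep.domain_constMul, hR₀d, hrd]) fun x hx => ?_
    simp only [IntegralRep.integrand_constMul]
    rw [hri hx, hR₀i, sin_pi_mul_one_third]
    norm_num
    ring
  -- `R₀ ∼ β` by the reflection `x ↦ 1 - x`
  have h2 : Equivalent R₀ β := by
    refine betaReflection_equivalent (-(2:ℝ) / 3) (-(1:ℝ) / 3) R₀ β hR₀d (fun x _ => ?_) hβd (fun x _ => ?_)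
    · rw [hR₀i]; norm_num
    · rw [hβi]; norm_num
  -- `(√3/2) · β ∼ p` is the instance `a = 2/3`
  have h3 : Equivalent (β.constMul (Real.sqrt 3 / 2) hc) p :=
    eulerReflectionRational_two_thirds _ p (by rw [IntegralRep.domain_constMul, hβd]) (fun x hx => by
      simp only [IntegralRep.integrand_constMul]
      rw [hβi, sin_pi_mul_two_thirds]
      norm_num
      ring) hpd hpi
  exact (h1.trans (h2.constMul (Real.sqrt 3 / 2) hc)).trans h3

end Summit.KontsevichZagierPeriods.KontsevichZagierPeriods.Theorems.GKZLevelThree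

end
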